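import Literature.Geometry.Lorentzian.CoordWeightedVectorEstimates
import Literature.Geometry.Lorentzian.CoordBochner
import HarnessLib

/-!
# The weighted vector-field identity at a boundary (Chruściel–Delay 2003, App. D, Cor. D.5)

Topic `Literature/Geometry/Lorentzian`, coordinate tensor calculus `MetricCoord` (Riemannian metric
components `G` on an open set `V`). Everything here is PROVED; no definition and no statement of
`Prop` type is introduced.

Sequel of `CoordWeightedVectorEstimates.lean` (Prop. D.2 of Chruściel–Delay, Mém. SMF 94 (2003)).
For a boundary defining function `x` (a smooth function on `V`, the collar being `{x > 0}`) we take
in Prop. D.2 the field `W = x⁻² ∇x` and the weight `u = −s/x + t log x` of Prop. C.4: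

* `IsMetricOn.covDAt_grad_apply`, `IsMetricOn.apply_covDAt_grad` — `∇_X ∇f = ♯ Hess f(X, ·)`,
  `G(∇_X ∇f, w) = Hess f(X, w)`;
* `IsMetricOn.boundaryVector_pointwise` — the computation of the proof of Cor. D.5: at a point
  with `x > 0`,
  `½ G(∇_Y W, Y) + ¼ (div W)|Y|² + ½ du(W)|Y|² + du(Y) G(Y,W)
    = x⁻⁴ [ s (½|∇x|²|Y|² + dx(Y)²) + x (t − 1)(½|∇x|²|Y|² + dx(Y)²) + x² (½ Hess x(Y,Y) + ¼ Δx |Y|²) ]`;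
* **`IsMetricOn.integral_boundaryVector`** — **Cor. D.5** as an exact identity: for `Y` smooth
  with compact support inside `{x > 0}`,
  `∫ √det g · e^{2u} [S(Y) + ½ tr S(Y) g](Y, x⁻²∇x) dμ
     = −∫ √det g · e^{2u} x⁻⁴ [ s (½|∇x|²|Y|² + dx(Y)²) + x (t−1)(…) + x² (½ Hess x(Y,Y) + ¼ Δx|Y|²) ] dμ`
  (printed: `−∫ x^{2t−4} e^{−2s/x} [ (s/2)(|dx|²|Y|² + 2⟨Y,∇x⟩²) + o(1)|Y|² ]`), the vector half of
  the coercivity estimate (3.4) near the boundary (Thm. 5.6) behind Thm. 5.9 and the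
  compact-annulus hypothesis `(E)` of `ChruscielDelay_parametricAnnulusGluing_of_compactCore`.

## References

* P. T. Chruściel, E. Delay, Mém. Soc. Math. Fr. 94 (2003), App. D, Prop. D.2, Cor. D.5.
  [ChruscielDelay2003]
* B. O'Neill, *Semi-Riemannian geometry*, 1983, Ch. 3, Prop. 3.13, Lemma 3.49. [ONeill1983]
-/

noncomputable section

set_option maxSynthPendingDepth 3

open Set Filter Module Function MeasureTheory
open scoped Topology ContDiff

namespace Literature.Geometry.Lorentzian

namespace MetricCoord

variable {E : Type*} [NormedAddCommGroup E] [NormedSpace ℝ E] [FiniteDimensional ℝ E]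
  [CompleteSpace E] {ι : Type*} [Fintype ι] [DecidableEq ι] (b : Basis ι ℝ E)
  {G : E → E →L[ℝ] E →L[ℝ] ℝ} {V : Set E} {x : E} {Y : E → E} {f : E → ℝ}

/-! ### `∇ ∇f = Hess f` -/

omit [FiniteDimensional ℝ E] [Fintype ι] [DecidableEq ι] in
/-- **`∇_X ∇f = ♯ Hess f(X,·)`** for `f` smooth on `V` (`∇_X Z = DZ(X) + Γ(Z, X)`,
`∂_X(♯Df) = ♯ Hess f(X,·) − Γ_X ♯Df`, torsion-freeness). [cite: ONeill1983, Ch. 3, Lemma 3.49] -/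
theorem IsMetricOn.covDAt_grad_apply (hG : IsMetricOn G V) (hx : x ∈ V)
    (hf : ContDiffOn ℝ ∞ f V) (X : E) :
    covDAt G (fun y ↦ sharpAt G y (fderiv ℝ f y)) x X = sharpAt G x (hessAt G f x X) := by
  rw [covDAt_apply, hG.fderiv_sharpAt_fderiv_apply hx hf X, hG.chrAt_comm hx _ X]
  abel

omit [FiniteDimensional ℝ E] [Fintype ι] [DecidableEq ι] in
/-- **`G(∇_X ∇f, w) = Hess f(X, w)`.** [cite: ONeill1983, Ch. 3, Lemma 3.49] -/
theorem IsMetricOn.apply_covDAt_grad (hG : IsMetricOn G V) (hx : x ∈ V)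
    (hf : ContDiffOn ℝ ∞ f V) (X w : E) :
    G x (covDAt G (fun y ↦ sharpAt G y (fderiv ℝ f y)) x X) w = hessAt G f x X w := by
  rw [hG.covDAt_grad_apply hx hf X, apply_sharpAt_apply (hG.isInvertible x hx)]

/-! ### The weight `u = −s/x + t log x` -/

/-- The one-variable profile `g(r) = −s/r + t log r`: derivative on `r > 0`. [folklore] -/
private theorem hasDerivAt_cdWeight (s t : ℝ) {r : ℝ} (hr : 0 < r) :
    HasDerivAt (fun r ↦ -s / r + t * Real.log r) (s / r ^ 2 + t / r) r := by
  have h1 : HasDerivAt (fun r : ℝ ↦ r⁻¹) (-(r ^ 2)⁻¹) r := hasDerivAt_inv hr.ne'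
  have h2 : HasDerivAt Real.log r⁻¹ r := Real.hasDerivAt_log hr.ne'
  have h := ((h1.const_mul (-s)).fun_add (h2.const_mul t)).congr_deriv
    (g' := s / r ^ 2 + t / r) (by field_simp)
  refine h.congr_of_eventuallyEq (Eventually.of_forall fun ρ ↦ ?_)
  simp only [div_eq_mul_inv, neg_mul]

omit [FiniteDimensional ℝ E] [CompleteSpace E] in
/-- `d(−s/x + t log x) = (s/x² + t/x) dx` at a point with `x > 0`. [folklore] -/
private theorem fderiv_cdWeight {xf : E → ℝ} {y : E} (s t : ℝ) (hy : 0 < xf y)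
    (hxf : DifferentiableAt ℝ xf y) :
    fderiv ℝ (fun z ↦ -s / xf z + t * Real.log (xf z)) y =
      (s / xf y ^ 2 + t / xf y) • fderiv ℝ xf y := by
  rw [fderiv_comp_eq_of_differentiableAt (g := fun r ↦ -s / r + t * Real.log r)
    (hasDerivAt_cdWeight s t hy).differentiableAt hxf, (hasDerivAt_cdWeight s t hy).deriv]

omit [FiniteDimensional ℝ E] [CompleteSpace E] in
/-- `d(x⁻²) = −2x⁻³ dx` at a point with `x ≠ 0`. [folklore] -/
private theorem fderiv_invSq {xf : E → ℝ} {y : E} (hy : xf y ≠ 0) (hxf : DifferentiableAt ℝ xf y) :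
    fderiv ℝ (fun z ↦ (xf z ^ 2)⁻¹) y = (-(2 : ℝ) / xf y ^ 3) • fderiv ℝ xf y := by
  have h : HasDerivAt (fun r : ℝ ↦ (r ^ 2)⁻¹) (-(2 * xf y ^ (2 - 1)) / (xf y ^ 2) ^ 2) (xf y) :=
    (hasDerivAt_pow 2 (xf y)).inv (pow_ne_zero 2 hy)
  rw [fderiv_comp_eq_of_differentiableAt (g := fun r ↦ (r ^ 2)⁻¹) h.differentiableAt hxf, h.deriv]
  congr 1
  simp only [Nat.add_one_sub_one, pow_one]
  field_simp

/-! ### The pointwise computation of Cor. D.5 -/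

omit [Fintype ι] [DecidableEq ι] in
/-- **The computation of the proof of Cor. D.5**: for `x` smooth on `V`, `x(y) > 0`, the field
`W = x⁻² ∇x`, the weight `u = −s/x + t log x` and any field `Y`,
`½ G(∇_Y W, Y) + ¼ (div W)|Y|² + ½ du(W)|Y|² + du(Y) G(Y,W)
 = x⁻⁴ [ s(½|∇x|²|Y|² + dx(Y)²) + x(t − 1)(½|∇x|²|Y|² + dx(Y)²) + x²(½ Hess x(Y,Y) + ¼ Δx|Y|²) ]`
(`∇_Y(x⁻²∇x) = x⁻² ∇_Y∇x − 2x⁻³ dx(Y) ∇x`, `div(x⁻²∇x) = x⁻²Δx − 2x⁻³|∇x|²`, `du = (s/x² + t/x)dx`).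
[cite: ChruscielDelay2003, App. D, Cor. D.5] -/
theorem IsMetricOn.boundaryVector_pointwise (hG : IsMetricOn G V) {xf : E → ℝ} {y : E}
    (hy : y ∈ V) (hxf : ContDiffOn ℝ ∞ xf V) (hx : 0 < xf y) (s t : ℝ) :
    2⁻¹ * G y (covDAt G (fun z ↦ (xf z ^ 2)⁻¹ • sharpAt G z (fderiv ℝ xf z)) y (Y y)) (Y y)
      + 4⁻¹ * divAt G (fun z ↦ (xf z ^ 2)⁻¹ • sharpAt G z (fderiv ℝ xf z)) y * G y (Y y) (Y y)
      + 2⁻¹ * fderiv ℝ (fun z ↦ -s / xf z + t * Real.log (xf z)) y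
          ((xf y ^ 2)⁻¹ • sharpAt G y (fderiv ℝ xf y)) * G y (Y y) (Y y)
      + fderiv ℝ (fun z ↦ -s / xf z + t * Real.log (xf z)) y (Y y)
          * G y (Y y) ((xf y ^ 2)⁻¹ • sharpAt G y (fderiv ℝ xf y)) =
      (xf y ^ 4)⁻¹ *
        (s * (2⁻¹ * gradSqAt G xf y * G y (Y y) (Y y) + fderiv ℝ xf y (Y y) ^ 2)
          + xf y * (t - 1) * (2⁻¹ * gradSqAt G xf y * G y (Y y) (Y y) + fderiv ℝ xf y (Y y) ^ 2)
          + xf y ^ 2 * (2⁻¹ * hessAt G xf y (Y y) (Y y) + 4⁻¹ * lapAt G xf y * G y (Y y) (Y y))) := by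
  have hi := hG.isInvertible y hy
  have hs := hG.symm y hy
  have hys : V ∈ 𝓝 y := hG.mem_nhds hy
  have hx0 : xf y ≠ 0 := hx.ne'
  have hxd : DifferentiableAt ℝ xf y := ((hxf y hy).contDiffAt hys).differentiableAt (by simp)
  have hψd : DifferentiableAt ℝ (fun z ↦ (xf z ^ 2)⁻¹) y := (hxd.pow 2).inv (pow_ne_zero 2 hx0)
  have hZs : ContDiffOn ℝ ∞ (fun z ↦ sharpAt G z (fderiv ℝ xf z)) V :=
    hG.contDiffOn_sharpAt.clm_apply (hxf.fderiv_of_isOpen hG.isOpen (by simp))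
  have hZd : DifferentiableAt ℝ (fun z ↦ sharpAt G z (fderiv ℝ xf z)) y :=
    ((hZs y hy).contDiffAt hys).differentiableAt (by simp)
  rw [covDAt_smul hψd hZd, divAt_smul hψd hZd, hG.divAt_sharpAt_fderiv hy hxf, fderiv_invSq hx0 hxd,
    fderiv_cdWeight s t hx hxd]
  simp only [_root_.add_apply, _root_.smul_apply, ContinuousLinearMap.smulRight_apply, map_add,
    map_smul, smul_eq_mul, hG.apply_covDAt_grad hy hxf, apply_sharpAt_apply hi,
    apply_apply_sharpAt hi hs, gradSqAt_apply]
  field_simp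
  ring

/-! ### Cor. D.5 integrated -/

omit [FiniteDimensional ℝ E] [CompleteSpace E] [Fintype ι] [DecidableEq ι] in
/-- Metric components on `V` are metric components on every open `U ⊆ V`. [folklore] -/
private theorem IsMetricOn.mono'' (hG : IsMetricOn G V) {U : Set E} (hU : IsOpen U) (hUV : U ⊆ V) :
    IsMetricOn G U :=
  ⟨hU, hG.contDiffOn.mono hUV, fun y hy ↦ hG.symm y (hUV hy), fun y hy ↦ hG.isInvertible y (hUV hy)⟩

section Integral

variable [MeasurableSpace E] [BorelSpace E] (μ : Measure E) [μ.IsAddHaarMeasure]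

/-- **Cor. D.5 of Chruściel–Delay 2003** (App. D), as an exact identity in coordinates: for
Riemannian metric components `G` on `V`, `x` smooth on `V`, and a field `Y` smooth on `V` with
compact support inside the collar `{x > 0}`, with `W = x⁻²∇x` and `u = −s/x + t log x`,
`∫ √det g · e^{2u} [ S(Y)(Y,W) + ½ (div Y) G(Y,W) ] dμ
  = −∫ √det g · e^{2u} x⁻⁴ [ s(½|∇x|²|Y|² + dx(Y)²) + x(t−1)(½|∇x|²|Y|² + dx(Y)²)
                               + x²(½ Hess x(Y,Y) + ¼ Δx|Y|²) ] dμ`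
(Prop. D.2 `IsMetricOn.integral_weightedVector` with `boundaryVector_pointwise`; the printed form
keeps `(s/2)(|dx|²|Y|² + 2⟨Y,∇x⟩²)` and collects the rest as `o(1)|Y|²`).
[cite: ChruscielDelay2003, App. D, Cor. D.5] -/
theorem IsMetricOn.integral_boundaryVector (hG : IsMetricOn G V)
    (hpos : ∀ y ∈ V, ∀ e : E, e ≠ 0 → 0 < G y e e) {xf : E → ℝ} (hxf : ContDiffOn ℝ ∞ xf V)
    (hY : ContDiffOn ℝ ∞ Y V) (hsupp : HasCompactSupport Y)
    (hYV : tsupport Y ⊆ {y ∈ V | 0 < xf y}) (s t : ℝ) :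
    ∫ y, sqrtDetGram G b y * (Real.exp (2 * (-s / xf y + t * Real.log (xf y))) *
        (symAt ((G y).comp (covDAt G Y y)) (Y y) ((xf y ^ 2)⁻¹ • sharpAt G y (fderiv ℝ xf y))
          + 2⁻¹ * divAt G Y y * G y (Y y) ((xf y ^ 2)⁻¹ • sharpAt G y (fderiv ℝ xf y)))) ∂μ =
      -∫ y, sqrtDetGram G b y * (Real.exp (2 * (-s / xf y + t * Real.log (xf y))) *
        ((xf y ^ 4)⁻¹ *
          (s * (2⁻¹ * gradSqAt G xf y * G y (Y y) (Y y) + fderiv ℝ xf y (Y y) ^ 2)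
            + xf y * (t - 1) * (2⁻¹ * gradSqAt G xf y * G y (Y y) (Y y) + fderiv ℝ xf y (Y y) ^ 2)
            + xf y ^ 2 * (2⁻¹ * hessAt G xf y (Y y) (Y y)
              + 4⁻¹ * lapAt G xf y * G y (Y y) (Y y))))) ∂μ := by
  -- the collar
  set V' : Set E := {y ∈ V | 0 < xf y} with hV'
  have hV'o : IsOpen V' :=
    hxf.continuousOn.isOpen_inter_preimage hG.isOpen isOpen_Ioi
  have hV'V : V' ⊆ V := fun y hy ↦ hy.1
  have hG' : IsMetricOn G V' := hG.mono'' hV'o hV'V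
  have hpos' : ∀ y ∈ V', ∀ e : E, e ≠ 0 → 0 < G y e e := fun y hy ↦ hpos y hy.1
  have hne : ∀ y ∈ V', xf y ≠ 0 := fun y hy ↦ hy.2.ne'
  have hxf' : ContDiffOn ℝ ∞ xf V' := hxf.mono hV'V
  have hW : ContDiffOn ℝ ∞ (fun y ↦ (xf y ^ 2)⁻¹ • sharpAt G y (fderiv ℝ xf y)) V' :=
    ((hxf'.pow 2).inv fun y hy ↦ pow_ne_zero 2 (hne y hy)).smul
      (hG'.contDiffOn_sharpAt.clm_apply (hxf'.fderiv_of_isOpen hV'o (by simp)))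
  have hu : ContDiffOn ℝ ∞ (fun y ↦ -s / xf y + t * Real.log (xf y)) V' := by
    have h1 : ContDiffOn ℝ ∞ (fun y ↦ (xf y)⁻¹) V' := hxf'.inv hne
    have h2 : ContDiffOn ℝ ∞ (fun y ↦ Real.log (xf y)) V' := hxf'.log hne
    refine ((h1.const_smul (-s)).add (h2.const_smul t)).congr fun y _ ↦ ?_
    simp only [smul_eq_mul, div_eq_mul_inv, neg_mul]
  rw [hG'.integral_weightedVector b μ hpos' (hY.mono hV'V) hsupp hYV hW hu]
  congr 1
  refine integral_congr_ae (Eventually.of_forall fun y ↦ ?_)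
  by_cases hy : y ∈ tsupport Y
  · have hyV' := hYV hy
    show sqrtDetGram G b y * _ = sqrtDetGram G b y * _
    rw [hG.boundaryVector_pointwise hyV'.1 hxf hyV'.2 s t]
  · have h0 : Y y = 0 := image_eq_zero_of_notMem_tsupport hy
    show sqrtDetGram G b y * _ = sqrtDetGram G b y * _
    simp only [h0, map_zero, _root_.zero_apply, mul_zero, add_zero, zero_pow two_ne_zero]

end Integral

end MetricCoord

end Literature.Geometry.Lorentzian

end
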